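import Mathlib
import HarnessLib
import HarnessLib.Audit
import Summits.MatrixMultiplication.Statement
import Literature.Computability.AlgebraicComplexity.MatrixMultiplicationExponentInf
import HarnessLib.Audit.Status.Attr

/-!
Route: WindowedCompletionRank

DORMANT since 2026-08-26T05:42:08Z (reconciler: no traction for 8.4 d (last activity item-evidence-added at 2026-08-17T19:45:58Z); parked, not closed — `ledger route dormant route-MatrixMultiplication-WindowedCompletionRank --off` to re) — unstaffed, not closed; items shared with open routes are served there. `ledger route dormant <id> --off` reactivates.

# Route WindowedCompletionRank — matmul = (abelian addition table, rank |G|) Hadamard (rank-c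
completion); omega <= log_n(|G| c) with |G| = n^(2+o(1))

X (GRADED COMPLETION RANK; realises card windowed-completion-rank-tpp and absorbs its retired
siblings
heisenberg-modulation-completion / cocycle-completion-rank): for every ε > 0 there are n ≥ 2, a
finite abelian
group G with |G| ≤ n^{2+ε}, index maps α, β, γ : [n]×[n] → G and a tensor S on G³ of rank R(S) ≤ n^ε
such that
the matrix multiplication tensor ⟨n,n,n⟩ is a restriction of the WINDOWED HADAMARD PRODUCT
W(a,b,c) = [α b + β c = γ a]·S(γ a, α b, β c) (format ([n]×[n])³; U_G(g;u,v) = [u+v = g] is the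
addition table
of G, of rank |G| over ℂ by the DFT). Then R(⟨n,n,n⟩) ≤ R(W) ≤ R(S)·|G| ≤ n^{2+2ε}, so ω ≤ 2+2ε. Two
frames
feed X: the WINDOW frame (matrix-unit basis, Cohn–Umans-form maps α = A(x)−B(y), β = B(y)+C(z), γ =
A(x)+C(z),
0/1 data, free cells off the window; crux WindowCompletion) and the WEYL frame (clock-and-shift
basis of
M_{m^k} = ℂ^ε[(ℤ_m^k)²], cocycle data ζ_m^{g₂·h₁} on the whole addition graph, |G| = n² exactly,
tensorises under
Kronecker powers; crux WeylCompletion). Either crux implies X (support WindowToThesis,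
WeylToThesis).
Lean: `∀ ε : ℝ, 0 < ε → ∃ n : ℕ, 2 ≤ n ∧ ∃ (G : Type) (_ : AddCommGroup G) (_ : Fintype G) (_ :
DecidableEq G), (Fintype.card G : ℝ) ≤ (n : ℝ) ^ (2 + ε) ∧ ∃ (α β γ : Fin n × Fin n → G) (S : G → G
→ G → ℂ), (Literature.Computability.AlgebraicComplexity.tensorRank S : ℝ) ≤ (n : ℝ) ^ ε ∧
Literature.Computability.AlgebraicComplexity.TensorRestrictsTo (fun a b c : Fin n × Fin n => if α b
+ β c = γ a then S (γ a) (α b) (β c) else 0)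
(Literature.Computability.AlgebraicComplexity.matMulTensor ℂ n n n)`

## Assembly
Bookkeeping over PROVED cone facts: fix ε > 0 and take n, G, α, β, γ, S from X. ⟨n,n,n⟩ ≤ W gives
R⟨n,n,n⟩ ≤ R(W)
(TensorRestrictsTo.tensorRank_le); W is the pull-back of T(g;u,v) = [u+v = g]·S(g,u,v) along (γ, α,
β), so R(W) ≤ R(T)
(tensorRestrictsTo_precomp); T = S ∘ U_G entrywise, so R(T) ≤ R(S)·R(U_G) ≤ n^ε·|G| ≤ n^{2+2ε}
(HadamardRankLe, AddTableRankLe);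
hence ω ≤ log_n(n^{2+2ε}) = 2+2ε (advxxz2025_omega_le_logb_of_tensorRank_le, n ≥ 2). Letting ε → 0
and using omega_two_le gives
ω(ℂ) = 2 = MatrixMultiplication. No named unproved fact is used.

Rationale: WHY THIS LINE. Mechanism (card windowed-completion-rank-tpp): relax the triple product property
multiplicatively — collisions are
allowed and paid for by the rank c of a completion S of a partial tensor prescribed only on the
addition graph of G;
since R(S∘U_G) ≤ R(S)·R(U_G) = R(S)·|G|, this turns the abelian regime |G| = n^{2+o(1)}, forbidden
for TPP
(CohnUmans2003 Lemma 3.1: abelian TPP forces |G| ≥ n³, i.e. c = 1 is useless), into a rank question;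
equivalently the
algorithms are exactly the rank decompositions of ⟨n,n,n⟩ that are unions of c FREE orbits of the
character group Ĝ
acting by the grading (torus modulations in the window frame, Heisenberg/Weyl conjugations in the
Weyl frame), cost
= c·|G| — a free-abelian-orbit version of the "algorithms from group orbits / algorithms with
symmetry" programme
(arXiv:1612.01527, arXiv:1708.09398, LandsbergGCT2017 Ch. 4, arXiv:2211.06485) and the dual of
Cohn–Umans s-rank
(arXiv:1207.6528: support fixed, values free; here values fixed on a Latin window, off-window
entries free).
Imported: graded-algebra structure theory (gradings of M_n(ℂ) by abelian groups are elementary ⊗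
Pauli,
doi:10.1006/jabr.2000.8643 — exactly the two frames), discrete Fourier analysis on finite abelian
groups (Mathlib
AddChar: rank of U_G, and the planner's Fourier-side reformulation: completions ↔ tensors with
prescribed line sums),
and symmetry-restricted algorithm search (Brent equations with a free abelian symmetry: 3|G|c
unknowns instead of 3n²r).
What is new relative to route GroupTheoreticSTPP (exact STPP, packing constructions) and the empty
negatives index: no
TPP/STPP set system at all; the planner's analysis this session already settles the naive questions
— the frame is NOT
cubic-bound (support DelegationBound: c ≤ R(⟨m,m,m⟩) at n = m³, e.g. R(⟨8,8,8⟩) ≤ 64·7 inside the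
frame), translation-
invariant completions are capped at rank ≥ √n (support InvariantSqrtBound, hence exponent ≥ 2.5 for
character
ansätze), and graded-indicator completions are TPP in G×ℤ_c (cubic) — so any gain must come from
symmetry-breaking,
cancelling completions, which is where the cruxes sit.

RANKED CRUXES. #0 Thesis (target) — X as in § Thesis: ∀ ε > 0 ∃ n ≥ 2, abelian G with |G| ≤ n^{2+ε},
index maps α β γ : [n]² → G and S with R(S) ≤ n^ε such that ⟨n,n,n⟩ is a restriction of the windowed
Hadamard product [α b + β c = γ a]·S(γ a, α b, β c). (why it might fail: every completion found so
far is recursion in disguise (cost ≥ n^{2+ω/3}); the conjectured barrier n³ ≤ |G|·R(S)² caps the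
window frame at exponent 2.5 and the Weyl frame shows no gain at n ≤ 3 (7 < 8, 19 > 18).)
[CohnUmans2003, arXiv:1612.01527, arXiv:1207.6528, doi:10.1006/jabr.2000.8643]
#2 WeylCompletion (crux) — Weyl-frame thesis (sibling K1, weakest form giving ω = 2): for every δ >
0 there are m ≥ 2, k ≥ 1 and a tensor S on ((ℤ_m^k)²)³ completing the Weyl 2-cocycle, S(g+h; g, h) =
ζ_m^{g₂·h₁} for all g, h (entries off the addition graph free), with R(S) ≤ m^{δk}; equivalently
⟨m^k⟩ has a rank-(m^{2k}·R(S)) decomposition that is a union of R(S) free orbits of the (ℤ_m^k)²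
clock-and-shift modulations. [difficulty: open-problem] (why it might fail: no gain is known at any
size (crank = m at m = 2, 3 is forced by R⟨2⟩ = 7, R⟨3⟩ ≥ 19); stabiliser/partition seeds and
one-point-per-line Fourier solutions provably give exactly the trivial value m (Fourier-matrix
phases block delegation).) [arXiv:1612.01527, LandsbergGCT2017, Conner2019, arXiv:2506.13131,
CohnUmans2003]
#3 WindowSqrtBarrier (crux) — NEGATIVE crux (window-frame no-go, replaces the card's refuted "N·c ≥
n³"): for every n, every finite abelian G, all A, B, C : [n] → G and every S satisfying the window
equation ⟨n,n,n⟩ = [αb+βc = γa]·S(γa,αb,βc) (α = A(x)−B(y), β = B(y)+C(z), γ = A(x)+C(z)), one has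
n³ ≤ |G|·R(S)². Holds for TPP (c = 1), the trivial completion, all product/delegation constructions
and all translation-invariant completions (InvariantSqrtBound); it caps the window frame at exponent
2.5 and kills WindowCompletion. [difficulty: L] (why it might fail: no lower-bound technique for
min-rank COMPLETIONS exists (all flattenings of the partial tensor complete to rank 1); first open
case n = 5, c = 2, 25 ≤ |G| ≤ 31 is not excluded by R⟨5⟩ ≥ 52 and would mean R⟨5,5,5⟩ ≤ 62.)
[CohnUmans2003, Blaser1999, Landsberg2014, arXiv:1207.6528]
#4 WeylBeatsTrivial (crux) — the Weyl frame is not inert: for some m ≥ 2, k ≥ 1 there is a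
completion S of the cocycle ζ_m^{g₂·h₁} on ((ℤ_m^k)²)³ with R(S) < m^k (the trivial completion,
constant in the output leg, has rank exactly m^k); e.g. crank(ε_4) = 3 or crank(ε_2^{⊗2}) = 3 is a
free-modulation-orbit reading of the 2025 record R⟨4,4,4⟩ ≤ 48 = 16·3 over ℂ; by Kronecker
submultiplicativity any instance gives ω ≤ 2 + log_{m^k} R(S) < 3 inside the frame. [difficulty: M]
(why it might fail: Strassen's family has symmetry group (S₃×ℤ₃)⋊ℤ₂ with no free Klein action (7 ≠
4c), ⟨3⟩ needs ≥ 19 > 18; if the 48-algorithm has no free ℤ₄²/𝔽₂⁴ modulation symmetry the first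
candidate is gone and short symmetric algorithms are rare (Burichenko).) [arXiv:2506.13131,
LandsbergGCT2017, arXiv:2211.06485, KauersMoosbauerWood2026, Conner2019]
#5 WindowCompletion (crux) — window-frame thesis (the card's X verbatim): for every ε > 0 there are
n ≥ 2, a finite abelian G with |G| ≤ n^{2+ε}, maps A, B, C : [n] → G and S with R(S) ≤ n^ε such that
⟨n,n,n⟩ EQUALS the window tensor [αb + βc = γa]·S(γa, αb, βc) with α(x,y) = A(x)−B(y), β(y,z) =
B(y)+C(z), γ(x,z) = A(x)+C(z) (the equation forces CU form and injectivity; c = 1 ⟺ TPP).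
[difficulty: open-problem] (why it might fail: WindowSqrtBarrier (true for every known completion:
TPP, products, delegation, translation-invariant) would cap this frame at exponent 2.5;
character/graded-indicator ansätze are provably useless (≥ √n resp. TPP in G×ℤ_c).) [CohnUmans2003,
CohnKleinbergSzegedyUmans2005, arXiv:1207.6528]
#9 HadamardRankLe (support) — Hadamard (entrywise) products are rank-submultiplicative: R(s∘t) ≤
R(s)·R(t) for 3-tensors over ℂ on finite index types (product of two triad decompositions).
[difficulty: provable-now] [BurgisserClausenShokrollahi1997, Blaser2013]
#9 AddTableRankLe (support) — the addition table U_G(c; a, b) = [a + b = c] of a finite abelian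
group has rank ≤ |G| over ℂ: [a+b−c = 0] = |G|⁻¹ Σ_ψ ψ(a)ψ(b)ψ(−c) over the |G| characters (Mathlib
AddChar.sum_apply_eq_ite, AddChar.card_eq). [difficulty: provable-now] [CohnUmans2003,
BurgisserClausenShokrollahi1997]
#9 WeylPresentation (support) — clock-and-shift presentation: with W_{(b,β)} e_c = ζ_m^{β·c} e_{c+b}
on ℂ^{ℤ_m^k} one has W_g W_h = ζ_m^{g₂·h₁} W_{g+h}, so M_{m^k} ≅ ℂ^ε[(ℤ_m^k)²] and ⟨m^k,m^k,m^k⟩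
(structure tensor in matrix units) is a restriction of the pulled-back twisted table [e b + e c = e
a]·S(e a, e b, e c) for every completion S of the cocycle and every bijection e : [m^k]² ≃ (ℤ_m^k)².
[difficulty: M] [LandsbergGCT2017, doi:10.1006/jabr.2000.8643]
#9 WeylToThesis (support) — glue: the Weyl presentation turns a Weyl-frame completion family into X
(n = m^k, G = (ℤ_m^k)², |G| = n², α = β = γ = any bijection, δ = ε). [difficulty: provable-now]
[LandsbergGCT2017]
#9 WindowToThesis (support) — glue: a window-frame family is an instance of X with α b = A b.1 − B
b.2, β c = B c.1 + C c.2, γ a = A a.1 + C a.2 and the identity restriction (TensorRestrictsTo.refl;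
checked sorry-free in Sketch.lean). [difficulty: provable-now] [CohnUmans2003]
#9 InvariantSqrtBound (support) — planner's no-go for character ansätze (full window G = ℤ_n², A(x)
= (x,0), B(y) = (y,y), C(z) = (0,z), data S(p+q; p, q) = [p₂ + q₁ = 0]): every completion invariant
under the translations (g,p,q) ↦ (g+u+v, p+u, q+v), u₂ + v₁ = 0, has R(S)² ≥ n. Proof sketch:
leg-wise DFT makes S a weighted sub-tensor Σ_F c'(x,y,z) e_{xy}⊗e_{yz}⊗e_{xz} of ⟨n,n,n⟩ whose
support F meets all n classes {x+y+z = k}; flattening ranks equal the projection sizes |π_xy F|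
etc., and |F| ≤ |π_xy F|·|π_z F|. [difficulty: M] [CohnUmans2003, BurgisserClausenShokrollahi1997]
#9 DelegationBound (support) — planner's delegation construction (refutes the card's cubic no-go
"N·c ≥ n³"): for n = m³ the invariant completion whose Fourier side is (1/n)·⟨m,m,m⟩ placed on the
digit tiling X₀+Y₀+Z₀ = ℤ_n (X₀ = {0..m−1}, Y₀ = mX₀, Z₀ = m²X₀) satisfies the ℤ_n² full-window
constraint and has R(S) ≤ R(⟨m,m,m⟩) (so c ≤ 7 at n = 8 and R⟨8,8,8⟩ ≤ 448 inside the frame; in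
general cost n²·R⟨n^{1/3}⟩, exponent 2 + ω/3 — recursion with a cubic outer level). Verified
numerically at m = 2 this session. [difficulty: M] [CohnUmans2003, Blaser2013]

TWO-LAYER PLAN. WeylBeatsTrivial proved at (m,k,c) ⇒ split WeylCompletion ⇐ KroneckerLadder
(crank(ε^{⊗(jk)}) ≤ c^j, support) → SecondGain
(a completion of ε_m^{⊗k'} of rank < c^{k'/k}, i.e. strict improvement under powering) →
WeylCompletion. WindowSqrtBarrier proved ⇒
drop WindowCompletion (route lives on the Weyl half; Thesis unchanged). WindowSqrtBarrier refuted by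
an explicit (n,G,S) ⇒ split
WindowCompletion ⇐ that family's tensorisation (G^k, coordinatewise maps) → rate → WindowCompletion.
k ≤ 3 children, depth 1.

KILL CRITERIA. A theorem "every graded presentation has |G|·R(S) ≥ n^{2+δ} for a fixed δ > 0"
(¬Thesis in effective form; e.g. WindowSqrtBarrier
together with a Weyl analogue crank(ε_m^{⊗k}) ≥ m^{δk} uniformly in m) closes the route
`refuted:Thesis`. WindowSqrtBarrier proved
alone kills only WindowCompletion (drop it). Exhaustive certified computations showing
crank(ε_m^{⊗k}) = m^k for all m^k ≤ 9 and no
window completion with |G|·c² < n³ for n ≤ 6 do not refute but send the route dormant. ω > 2 (route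
BorderRankLowerBound) closes
everything; AThesis of route AsymptoticSpectrum proved moots it.

NOT DECOMPOSED YET. Which groups/maps in the window frame beyond the full window (|G| > n²,
genuinely free off-window cells — the card's original
selling point) — layer-2 children of WindowCompletion once WindowSqrtBarrier is decided; the mixed
frame (elementary ⊗ Pauli gradings
of M_{km}, doi:10.1006/jabr.2000.8643) — a child of Thesis if both pure frames stall; border-rank /
degeneration versions of c
(would need algBorderRank of completions); the division-algebra twin ω = log_d R̃_k(T_D) of the
retired cocycle card (ω-inert
alone); exact values crank(ε_m) for m ≤ 7 (computation support, filed when WeylBeatsTrivial is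
claimed).

CHEAPEST FALSIFIER. kit: Levenberg–Marquardt / alternating least squares on the Brent-type system
for a rank-3 completion of ε_4 (ℤ_4² frame:
3·3·16 = 144 unknowns, 256 trilinear equations) and of ε_2^{⊗2} (𝔽_2⁴ frame), then rank m−1 for ℤ_5,
ℤ_7 — a hit PROVES
WeylBeatsTrivial (and at m = 4 re-derives 48 = 16·3 conceptually), uniform failure is the first
evidence against WeylCompletion;
window side: exact (Gröbner, the rank-2 system is multiplicatively linear on collisions) search for
rank-2 window completions at
n = 5, 25 ≤ |G| ≤ 31 — a hit refutes WindowSqrtBarrier and gives R⟨5,5,5⟩ ≤ 62. Lookup: whether the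
published rank-48 complex
⟨4,4,4⟩ decomposition (arXiv:2506.13131) is a union of 3 free ℤ_4²- or 𝔽_2⁴-modulation orbits. Not
run this session (planner; compute
is off-box): filed as the refuters' first move.

NUMBERS. R⟨2,2,2⟩ = 7 ⇒ c = crank(ε_2) = 2 (no gain at n = 2); 19 ≤ R⟨3,3,3⟩ ≤ 23 ⇒ c(3) = 3 in
every frame with |G| = 9; R⟨4,4,4⟩ ≤ 48
over ℂ (arXiv:2506.13131), ≥ 33 ⇒ crank(ε_4) ∈ {3,4}; general frame bounds 3 ≤ c(n) ≤ min(n,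
R⟨n^{1/3}⟩) (lower: R⟨n⟩ ≥ 3n²−o(n²),
Landsberg2014; upper: trivial completion / DelegationBound), invariant completions c ≥ √n
(InvariantSqrtBound). Record ω ≤ 2.371339
(AlmanDuanVassilevskaWilliamsXuXuZhou2025): one instance beats it iff log_n(|G|·c) < 2.3713, e.g.
|G| = n² = 2^{20} needs c ≤ 13.
Items at open: 13 (1 target, 4 cruxes, 7 support, 1 assembly).

DEFINITION REQUESTS. None: U_G, the window tensor, the cocycle and completion rank are written
inline over tensorRank / matMulTensor / TensorRestrictsTo
(Literature.Computability.AlgebraicComplexity) and Mathlib's ZMod / AddChar; no cite facts are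
needed by the assembly (all cone facts
used are proved: advxxz2025_omega_le_logb_of_tensorRank_le, omega_two_le,
TensorRestrictsTo.tensorRank_le, tensorRestrictsTo_precomp).

Novelty: Searches (2026-08-15): `lit search --source zbmath "matrix multiplication group orbits"` (15:
arXiv:1612.01527, arXiv:1708.09398,
arXiv:2211.03404 found); `lit search --source zbmath "symmetries of matrix multiplication
algorithms"` (15: arXiv:2211.06485,
arXiv:2210.16565, Kaporin 2024 complex Brent solutions); `lit search --source zbmath "fine gradings
matrix algebra abelian group
classification"` (6: Elduque–Kochetov 2013, arXiv:1210.4589); `lit search --source zbmath "Bahturin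
Sehgal Zaicev group gradings
associative algebras"` (doi:10.1006/jabr.2000.8643); `lit search --hybrid --source local
"decomposition of matrix multiplication tensor
invariant under cyclic group ... Strassen symmetry group"` (LandsbergGCT2017 pp. 84–96 read: §4.1.2,
Conj. 4.1.4.3 [BILR], Thm. 4.3.2.1
[Bur14]); zbMATH "gradings matrix algebra twisted group algebra bilinear complexity" (0) and
"invariant decomposition matrix multiplication
tensor cyclic group symmetry algorithm" (0); `lit read arxiv:2211.03404`, `lit read
arxiv:2211.06485` (pp. 1–3); arXiv / OpenAlex / S2
answered HTTP 429 and `lit galaxy search ... --star all` queued out this session (logged gap); plus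
the audited searches of the card
and its two retired siblings (zbMATH 'Hadamard product tensor rank matrix multiplication' 0,
'minimum rank completion partial tensor'
0, galaxy 'twisted group algebra matrix multiplication' 0, 2026-08-15).
Nearest prior art found: arXiv:1612.01527 / arXiv:1708.09398 (Grochow–Moore: algorithms as unions of  [refs: 10.1006/jabr.2000.8643, 1612.01527, 1708.09398, 2211.03404, 2211.06485, 2210.16565, 1210.4589, 1207.6528, doi:10.1006/jabr.2000.8643, arxiv:2211.03404, arxiv:2211.06485, LandsbergGCT2017, CohnUmans2003, CohnKleinbergSzegedyUmans2005]

Barriers (technique_class: completion-rank, group-orbit-algorithms, hadamard): - technique_class: completion-rank, group-orbit-algorithms, hadamard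
- Literature.Barriers.MatrixMultiplication.InfimumNotMinimumBarrier: respected — a single (G,S)
certifies only ω ≤ log_n(|G|·R(S)) > 2 (c ≥ 3 for n ≥ 3, |G| ≥ n²);
Thesis/WeylCompletion/WindowCompletion quantify a family ε → 0, and WeylBeatsTrivial is explicitly a
strict-inequality milestone.
- Literature.Barriers.MatrixMultiplication.TricoloredSumFreeBarrier: bites exactly at c = 1 (a
coordinate embedding of ⟨n,n,n⟩ into U_G with no collisions is abelian TPP, dead by CohnUmans2003
Lemma 3.1 before slice rank is needed); for c ≥ 2 the zero pattern is supplied by S, no tricolored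
sum-free set is produced, and over ℂ U_G ≅ ⟨|G|⟩ has full slice rank, so bounded exponent ((ℤ_m^k)²
in the Weyl frame) is not obstructed — the bet is that cancelling completions exist there.
- Literature.Barriers.MatrixMultiplication.IrreversibilityBarrier: void — the only auxiliary tensor
is U_G ≅ ⟨|G|⟩ (irreversibility 1); what is powered in the Weyl frame is ⟨m,m,m⟩ itself.
- Literature.Barriers.MatrixMultiplication.UniversalMethodBarrier: void for the same reason (no
fixed intermediate tensor of sub-maximal asymptotic subrank is degenerated).
- Literature.Barriers.MatrixMultiplication.UnstableTensorBarrier: void — U_G and ⟨n,n,n⟩ are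
semistable/tight; no unstable starting tensor.
- Literature.Barriers.MatrixMultiplication.LinearRankMethodBarrier: relevant only to PROVING
WindowSqrtBarrier: completion-rank lower bounds are minima

History (route lifecycle, newest last):
- 2026-08-16T04:11:36Z · AUTO-CRUX (backfill): Thesis — hypotheses of the deciding theorem that nothing in the route derives are cruxes (operator:999:1085951)
- 2026-08-26T05:42:08Z · DORMANT — reconciler: no traction for 8.4 d (last activity item-evidence-added at 2026-08-17T19:45:58Z); parked, not closed — `ledger route dormant route-MatrixMultiplica (operator:999:709531)

sub-problem: MatrixMultiplication · status: dormant · opened planner-plancard-MatrixMultiplication-MatrixM-d3ecb55b-0 2026-08-15T11:41:20Z · rev 1 · ledger route-MatrixMultiplication-WindowedCompletionRank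
GENERATED by the gate from the ledger (D-0016/17). Provers cite these decls: `theorem foo : Summit.MatrixMultiplication.MatrixMultiplication.Theses.WindowedCompletionRank.<Decl> := …` in Summits/MatrixMultiplication/MatrixMultiplication/Theorems/<Name>.lean.
-/

namespace Summit.MatrixMultiplication.MatrixMultiplication.Theses.WindowedCompletionRank

open scoped BigOperators Topology Manifold Classical MeasureTheory ProbabilityTheory Matrix InnerProductSpace ComplexConjugate ContinuousMap
open Filter Set Function TopologicalSpace MeasureTheory

attribute [summit_statement] _root_.MatrixMultiplication

/-- item stmt-MatrixMultiplication-5491 · crux (kind.auto-crux: conjecture-grade) · rank 0 · open · by planner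
why it might fail: every completion found so far is recursion in disguise (cost ≥ n^{2+ω/3}); the conjectured barrier n³ ≤ |G|·R(S)² caps the window frame at exponent 2.5 and the Weyl frame shows no gain at n ≤ 3 (7 < 8, 19 > 18).
sources: CohnUmans2003, arXiv:1612.01527, arXiv:1207.6528, doi:10.1006/jabr.2000.8643
[target] X as in § Thesis: ∀ ε > 0 ∃ n ≥ 2, abelian G with |G| ≤ n^{2+ε}, index maps α β γ : [n]² →
G and S with R(S) ≤ n^ε such that ⟨n,n,n⟩ is a restriction of the windowed Hadamard product [α b + β
c = γ a]·S(γ a, α b, β c). -/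
@[route_item "route-MatrixMultiplication-WindowedCompletionRank", crux]
def Thesis : Prop :=
  ∀ ε : ℝ, 0 < ε → ∃ n : ℕ, 2 ≤ n ∧ ∃ (G : Type) (_ : AddCommGroup G) (_ : Fintype G) (_ : DecidableEq G), (Fintype.card G : ℝ) ≤ (n : ℝ) ^ (2 + ε) ∧ ∃ (α β γ : Fin n × Fin n → G) (S : G → G → G → ℂ), (Literature.Computability.AlgebraicComplexity.tensorRank S : ℝ) ≤ (n : ℝ) ^ ε ∧ Literature.Computability.AlgebraicComplexity.TensorRestrictsTo (fun a b c : Fin n × Fin n => if α b + β c = γ a then S (γ a) (α b) (β c) else 0) (Literature.Computability.AlgebraicComplexity.matMulTensor ℂ n n n)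

/-- item stmt-MatrixMultiplication-5492 · crux · rank 2 · open · by planner
why it might fail: no gain is known at any size (crank = m at m = 2, 3 is forced by R⟨2⟩ = 7, R⟨3⟩ ≥ 19); stabiliser/partition seeds and one-point-per-line Fourier solutions provably give exactly the trivial value m (Fourier-matrix phases block delegation).
sources: arXiv:1612.01527, LandsbergGCT2017, Conner2019, arXiv:2506.13131, CohnUmans2003
[crux] Weyl-frame thesis (sibling K1, weakest form giving ω = 2): for every δ > 0 there are m ≥ 2, k
≥ 1 and a tensor S on ((ℤ_m^k)²)³ completing the Weyl 2-cocycle, S(g+h; g, h) = ζ_m^{g₂·h₁} for all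
g, h (entries off the addition graph free), with R(S) ≤ m^{δk}; equivalently ⟨m^k⟩ has a
rank-(m^{2k}·R(S)) decomposition that is a union of R(S) free orbits of the (ℤ_m^k)² clock-and-shift
modulations. [difficulty: open-problem] -/
@[route_item "route-MatrixMultiplication-WindowedCompletionRank"]
def WeylCompletion : Prop :=
  ∀ δ : ℝ, 0 < δ → ∃ m : ℕ, 2 ≤ m ∧ ∃ k : ℕ, 1 ≤ k ∧ ∃ S : ((Fin k → ZMod m) × (Fin k → ZMod m)) → ((Fin k → ZMod m) × (Fin k → ZMod m)) → ((Fin k → ZMod m) × (Fin k → ZMod m)) → ℂ, (∀ g h : (Fin k → ZMod m) × (Fin k → ZMod m), S (g + h) g h = Complex.exp (2 * Real.pi * Complex.I * ((∑ i, g.2 i * h.1 i).val : ℂ) / m)) ∧ (Literature.Computability.AlgebraicComplexity.tensorRank S : ℝ) ≤ (m : ℝ) ^ (δ * k)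

/-- item stmt-MatrixMultiplication-5493 · crux · rank 3 · open · by planner
why it might fail: no lower-bound technique for min-rank COMPLETIONS exists (all flattenings of the partial tensor complete to rank 1); first open case n = 5, c = 2, 25 ≤ |G| ≤ 31 is not excluded by R⟨5⟩ ≥ 52 and would mean R⟨5,5,5⟩ ≤ 62.
sources: CohnUmans2003, Blaser1999, Landsberg2014, arXiv:1207.6528
[crux] NEGATIVE crux (window-frame no-go, replaces the card's refuted "N·c ≥ n³"): for every n,
every finite abelian G, all A, B, C : [n] → G and every S satisfying the window equation ⟨n,n,n⟩ =
[αb+βc = γa]·S(γa,αb,βc) (α = A(x)−B(y), β = B(y)+C(z), γ = A(x)+C(z)), one has n³ ≤ |G|·R(S)².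
Holds for TPP (c = 1), the trivial completion, all product/delegation constructions and all
translation-invariant completions (InvariantSqrtBound); it caps the window frame at exponent 2.5 and
kills WindowCompletion. [difficulty: L] -/
@[route_item "route-MatrixMultiplication-WindowedCompletionRank"]
def WindowSqrtBarrier : Prop :=
  ∀ (n : ℕ) (G : Type) [AddCommGroup G] [Fintype G] [DecidableEq G] (A B C : Fin n → G) (S : G → G → G → ℂ), (Literature.Computability.AlgebraicComplexity.matMulTensor ℂ n n n = fun a b c => if (A b.1 - B b.2) + (B c.1 + C c.2) = A a.1 + C a.2 then S (A a.1 + C a.2) (A b.1 - B b.2) (B c.1 + C c.2) else 0) → n ^ 3 ≤ Fintype.card G * Literature.Computability.AlgebraicComplexity.tensorRank S ^ 2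

/-- item stmt-MatrixMultiplication-5494 · crux · rank 4 · closed · proved by Summit.MatrixMultiplication.MatrixMultiplication.Theorems.Thesis.stub_weylSeed (prover) · by planner
why it might fail: Strassen's family has symmetry group (S₃×ℤ₃)⋊ℤ₂ with no free Klein action (7 ≠ 4c), ⟨3⟩ needs ≥ 19 > 18; if the 48-algorithm has no free ℤ₄²/𝔽₂⁴ modulation symmetry the first candidate is gone and short symmetric algorithms are rare (Burichenko).
sources: arXiv:2506.13131, LandsbergGCT2017, arXiv:2211.06485, KauersMoosbauerWood2026, Conner2019
[crux] the Weyl frame is not inert: for some m ≥ 2, k ≥ 1 there is a completion S of the cocycle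
ζ_m^{g₂·h₁} on ((ℤ_m^k)²)³ with R(S) < m^k (the trivial completion, constant in the output leg, has
rank exactly m^k); e.g. crank(ε_4) = 3 or crank(ε_2^{⊗2}) = 3 is a free-modulation-orbit reading of
the 2025 record R⟨4,4,4⟩ ≤ 48 = 16·3 over ℂ; by Kronecker submultiplicativity any instance gives ω ≤
2 + log_{m^k} R(S) < 3 inside the frame. [difficulty: M] -/
@[route_item "route-MatrixMultiplication-WindowedCompletionRank"]
def WeylBeatsTrivial : Prop :=
  ∃ m : ℕ, 2 ≤ m ∧ ∃ k : ℕ, 1 ≤ k ∧ ∃ S : ((Fin k → ZMod m) × (Fin k → ZMod m)) → ((Fin k → ZMod m) × (Fin k → ZMod m)) → ((Fin k → ZMod m) × (Fin k → ZMod m)) → ℂ, (∀ g h : (Fin k → ZMod m) × (Fin k → ZMod m), S (g + h) g h = Complex.exp (2 * Real.pi * Complex.I * ((∑ i, g.2 i * h.1 i).val : ℂ) / m)) ∧ Literature.Computability.AlgebraicComplexity.tensorRank S < m ^ k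

-- `WeylBeatsTrivial` holds: proved by `Summit.MatrixMultiplication.MatrixMultiplication.Theorems.Thesis.stub_weylSeed` (its module imports this route file, so no `_holds` link can be stated here).

/-- item stmt-MatrixMultiplication-5495 · crux · rank 5 · open · by planner
why it might fail: WindowSqrtBarrier (true for every known completion: TPP, products, delegation, translation-invariant) would cap this frame at exponent 2.5; character/graded-indicator ansätze are provably useless (≥ √n resp. TPP in G×ℤ_c).
sources: CohnUmans2003, CohnKleinbergSzegedyUmans2005, arXiv:1207.6528
[crux] window-frame thesis (the card's X verbatim): for every ε > 0 there are n ≥ 2, a finite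
abelian G with |G| ≤ n^{2+ε}, maps A, B, C : [n] → G and S with R(S) ≤ n^ε such that ⟨n,n,n⟩ EQUALS
the window tensor [αb + βc = γa]·S(γa, αb, βc) with α(x,y) = A(x)−B(y), β(y,z) = B(y)+C(z), γ(x,z) =
A(x)+C(z) (the equation forces CU form and injectivity; c = 1 ⟺ TPP). [difficulty: open-problem] -/
@[route_item "route-MatrixMultiplication-WindowedCompletionRank"]
def WindowCompletion : Prop :=
  ∀ ε : ℝ, 0 < ε → ∃ n : ℕ, 2 ≤ n ∧ ∃ (G : Type) (_ : AddCommGroup G) (_ : Fintype G) (_ : DecidableEq G), (Fintype.card G : ℝ) ≤ (n : ℝ) ^ (2 + ε) ∧ ∃ (A B C : Fin n → G) (S : G → G → G → ℂ), (Literature.Computability.AlgebraicComplexity.tensorRank S : ℝ) ≤ (n : ℝ) ^ ε ∧ Literature.Computability.AlgebraicComplexity.matMulTensor ℂ n n n = fun a b c => if (A b.1 - B b.2) + (B c.1 + C c.2) = A a.1 + C a.2 then S (A a.1 + C a.2) (A b.1 - B b.2) (B c.1 + C c.2) else 0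

/-- item stmt-MatrixMultiplication-5496 · support · rank 9 · closed · proved by Summit.MatrixMultiplication.MatrixMultiplication.Theorems.designFlattening_hadamardRankLe_proof @ eeba7a06571e (prover) · by planner
sources: BurgisserClausenShokrollahi1997, Blaser2013
[support] Hadamard (entrywise) products are rank-submultiplicative: R(s∘t) ≤ R(s)·R(t) for 3-tensors
over ℂ on finite index types (product of two triad decompositions). [difficulty: provable-now] -/
@[route_item "route-MatrixMultiplication-WindowedCompletionRank", crux]
def HadamardRankLe : Prop :=
  ∀ (ι κ μ : Type) [Fintype ι] [Fintype κ] [Fintype μ] (s t : ι → κ → μ → ℂ), Literature.Computability.AlgebraicComplexity.tensorRank (fun a b c => s a b c * t a b c) ≤ Literature.Computability.AlgebraicComplexity.tensorRank s * Literature.Computability.AlgebraicComplexity.tensorRank t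

-- `HadamardRankLe` holds: proved by `Summit.MatrixMultiplication.MatrixMultiplication.Theorems.designFlattening_hadamardRankLe_proof` @ eeba7a06571e (its module imports this route file, so no `_holds` link can be stated here).

/-- item stmt-MatrixMultiplication-5497 · support · rank 9 · closed · proved by Summit.MatrixMultiplication.MatrixMultiplication.Theorems.designFlattening_addTableRankLe_proof @ 683a8e7cca29 (prover) · by planner
sources: CohnUmans2003, BurgisserClausenShokrollahi1997
[support] the addition table U_G(c; a, b) = [a + b = c] of a finite abelian group has rank ≤ |G|
over ℂ: [a+b−c = 0] = |G|⁻¹ Σ_ψ ψ(a)ψ(b)ψ(−c) over the |G| characters (Mathlib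
AddChar.sum_apply_eq_ite, AddChar.card_eq). [difficulty: provable-now] -/
@[route_item "route-MatrixMultiplication-WindowedCompletionRank", crux]
def AddTableRankLe : Prop :=
  ∀ (G : Type) [AddCommGroup G] [Fintype G] [DecidableEq G], Literature.Computability.AlgebraicComplexity.tensorRank (fun c a b : G => if a + b = c then (1 : ℂ) else 0) ≤ Fintype.card G

-- `AddTableRankLe` holds: proved by `Summit.MatrixMultiplication.MatrixMultiplication.Theorems.designFlattening_addTableRankLe_proof` @ 683a8e7cca29 (its module imports this route file, so no `_holds` link can be stated here).

/-- item stmt-MatrixMultiplication-5498 · support · rank 9 · closed · proved by Summit.MatrixMultiplication.MatrixMultiplication.Theorems.weylPresentation_proof @ 02883de4a53b (prover) · by planner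
sources: LandsbergGCT2017, doi:10.1006/jabr.2000.8643
[support] clock-and-shift presentation: with W_{(b,β)} e_c = ζ_m^{β·c} e_{c+b} on ℂ^{ℤ_m^k} one has
W_g W_h = ζ_m^{g₂·h₁} W_{g+h}, so M_{m^k} ≅ ℂ^ε[(ℤ_m^k)²] and ⟨m^k,m^k,m^k⟩ (structure tensor in
matrix units) is a restriction of the pulled-back twisted table [e b + e c = e a]·S(e a, e b, e c)
for every completion S of the cocycle and every bijection e : [m^k]² ≃ (ℤ_m^k)². [difficulty: M] -/
@[route_item "route-MatrixMultiplication-WindowedCompletionRank"]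
def WeylPresentation : Prop :=
  ∀ (m k : ℕ), 1 ≤ m → ∀ (S : ((Fin k → ZMod m) × (Fin k → ZMod m)) → ((Fin k → ZMod m) × (Fin k → ZMod m)) → ((Fin k → ZMod m) × (Fin k → ZMod m)) → ℂ), (∀ g h : (Fin k → ZMod m) × (Fin k → ZMod m), S (g + h) g h = Complex.exp (2 * Real.pi * Complex.I * ((∑ i, g.2 i * h.1 i).val : ℂ) / m)) → ∀ e : Fin (m ^ k) × Fin (m ^ k) ≃ (Fin k → ZMod m) × (Fin k → ZMod m), Literature.Computability.AlgebraicComplexity.TensorRestrictsTo (fun a b c : Fin (m ^ k) × Fin (m ^ k) => if e b + e c = e a then S (e a) (e b) (e c) else 0) (Literature.Computability.AlgebraicComplexity.matMulTensor ℂ (m ^ k) (m ^ k) (m ^ k))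

-- `WeylPresentation` holds: proved by `Summit.MatrixMultiplication.MatrixMultiplication.Theorems.weylPresentation_proof` @ 02883de4a53b (its module imports this route file, so no `_holds` link can be stated here).

/-- item stmt-MatrixMultiplication-5499 · support · rank 9 · closed · proved by Summit.MatrixMultiplication.MatrixMultiplication.Theorems.weylToThesis_proof @ 0a922b7bdcb3 (prover) · by planner
sources: LandsbergGCT2017
[support] glue: the Weyl presentation turns a Weyl-frame completion family into X (n = m^k, G =
(ℤ_m^k)², |G| = n², α = β = γ = any bijection, δ = ε). [difficulty: provable-now] -/
@[route_item "route-MatrixMultiplication-WindowedCompletionRank"]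
def WeylToThesis : Prop :=
  WeylPresentation → WeylCompletion → Thesis

-- `WeylToThesis` holds: proved by `Summit.MatrixMultiplication.MatrixMultiplication.Theorems.weylToThesis_proof` @ 0a922b7bdcb3 (its module imports this route file, so no `_holds` link can be stated here).

/-- item stmt-MatrixMultiplication-5500 · support · rank 9 · closed · proved by Summit.MatrixMultiplication.MatrixMultiplication.Theorems.windowToThesis_proof @ 1dd295dec660 (prover) · by planner
sources: CohnUmans2003
[support] glue: a window-frame family is an instance of X with α b = A b.1 − B b.2, β c = B c.1 + C
c.2, γ a = A a.1 + C a.2 and the identity restriction (TensorRestrictsTo.refl; checked sorry-free in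
Sketch.lean). [difficulty: provable-now] -/
@[route_item "route-MatrixMultiplication-WindowedCompletionRank"]
def WindowToThesis : Prop :=
  WindowCompletion → Thesis

-- `WindowToThesis` holds: proved by `Summit.MatrixMultiplication.MatrixMultiplication.Theorems.windowToThesis_proof` @ 1dd295dec660 (its module imports this route file, so no `_holds` link can be stated here).

/-- item stmt-MatrixMultiplication-5501 · support · rank 9 · closed · proved by Summit.MatrixMultiplication.MatrixMultiplication.Theorems.invariantSqrtBound_proof @ d76edc7e4e3d (prover) · by planner
sources: CohnUmans2003, BurgisserClausenShokrollahi1997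
[support] planner's no-go for character ansätze (full window G = ℤ_n², A(x) = (x,0), B(y) = (y,y),
C(z) = (0,z), data S(p+q; p, q) = [p₂ + q₁ = 0]): every completion invariant under the translations
(g,p,q) ↦ (g+u+v, p+u, q+v), u₂ + v₁ = 0, has R(S)² ≥ n. Proof sketch: leg-wise DFT makes S a
weighted sub-tensor Σ_F c'(x,y,z) e_{xy}⊗e_{yz}⊗e_{xz} of ⟨n,n,n⟩ whose support F meets all n
classes {x+y+z = k}; flattening ranks equal the projection sizes |π_xy F| etc., and |F| ≤ |π_xy
F|·|π_z F|. [difficulty: M] -/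
@[route_item "route-MatrixMultiplication-WindowedCompletionRank"]
def InvariantSqrtBound : Prop :=
  ∀ (n : ℕ) [NeZero n] (S : (ZMod n × ZMod n) → (ZMod n × ZMod n) → (ZMod n × ZMod n) → ℂ), (∀ p q : ZMod n × ZMod n, S (p + q) p q = if p.2 + q.1 = 0 then 1 else 0) → (∀ g p q u v : ZMod n × ZMod n, u.2 + v.1 = 0 → S (g + (u + v)) (p + u) (q + v) = S g p q) → n ≤ Literature.Computability.AlgebraicComplexity.tensorRank S ^ 2

-- `InvariantSqrtBound` holds: proved by `Summit.MatrixMultiplication.MatrixMultiplication.Theorems.invariantSqrtBound_proof` @ d76edc7e4e3d (its module imports this route file, so no `_holds` link can be stated here).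

/-- item stmt-MatrixMultiplication-5502 · support · rank 9 · closed · proved by Summit.MatrixMultiplication.MatrixMultiplication.Theorems.delegationBound_proof @ 98fbf36d5a5c (prover) · by planner
sources: CohnUmans2003, Blaser2013
[support] planner's delegation construction (refutes the card's cubic no-go "N·c ≥ n³"): for n = m³
the invariant completion whose Fourier side is (1/n)·⟨m,m,m⟩ placed on the digit tiling X₀+Y₀+Z₀ =
ℤ_n (X₀ = {0..m−1}, Y₀ = mX₀, Z₀ = m²X₀) satisfies the ℤ_n² full-window constraint and has R(S) ≤
R(⟨m,m,m⟩) (so c ≤ 7 at n = 8 and R⟨8,8,8⟩ ≤ 448 inside the frame; in general cost n²·R⟨n^{1/3}⟩,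
exponent 2 + ω/3 — recursion with a cubic outer level). Verified numerically at m = 2 this session.
[difficulty: M] -/
@[route_item "route-MatrixMultiplication-WindowedCompletionRank"]
def DelegationBound : Prop :=
  ∀ m : ℕ, 1 ≤ m → ∃ S : (ZMod (m ^ 3) × ZMod (m ^ 3)) → (ZMod (m ^ 3) × ZMod (m ^ 3)) → (ZMod (m ^ 3) × ZMod (m ^ 3)) → ℂ, (∀ p q : ZMod (m ^ 3) × ZMod (m ^ 3), S (p + q) p q = if p.2 + q.1 = 0 then 1 else 0) ∧ (∀ g p q u v : ZMod (m ^ 3) × ZMod (m ^ 3), u.2 + v.1 = 0 → S (g + (u + v)) (p + u) (q + v) = S g p q) ∧ Literature.Computability.AlgebraicComplexity.tensorRank S ≤ Literature.Computability.AlgebraicComplexity.tensorRank (Literature.Computability.AlgebraicComplexity.matMulTensor ℂ m m m)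

-- `DelegationBound` holds: proved by `Summit.MatrixMultiplication.MatrixMultiplication.Theorems.delegationBound_proof` @ 98fbf36d5a5c (its module imports this route file, so no `_holds` link can be stated here).

/-- item stmt-MatrixMultiplication-5503 · assembly · rank 1 · closed · proved by Summit.MatrixMultiplication.MatrixMultiplication.Theorems.windowedCompletionRank_assembly_proof @ a32097947c67 (prover) · by planner
sources: Blaser2013, AlmanDuanVassilevskaWilliamsXuXuZhou2025, CohnUmans2003
[assembly] HadamardRankLe → AddTableRankLe → Thesis → MatrixMultiplication (ω ≤ 2+2ε for every ε
from R⟨n,n,n⟩ ≤ |G|·R(S), plus ω ≥ 2). -/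
@[route_item "route-MatrixMultiplication-WindowedCompletionRank"]
def Assembly : Prop :=
  HadamardRankLe → AddTableRankLe → Thesis → MatrixMultiplication

-- `Assembly` holds: proved by `Summit.MatrixMultiplication.MatrixMultiplication.Theorems.windowedCompletionRank_assembly_proof` @ a32097947c67 (its module imports this route file, so no `_holds` link can be stated here).

/-! D-0027 §2.1 — DECIDING THEOREM (planner-authored via `route open/edit --closes-file`; by planner-rbadge-MatrixMultiplication-WindowedCo-641f1b53-g2-0 2026-08-15T16:18:28Z):
its hypotheses are this route's items and its conclusion the sub-problem Statement (glue_lint), and it elaborates with this file. -/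

/-- DECIDING THEOREM (D-0027 §2.1): the target `Thesis` (graded completion rank: for every ε > 0 a
presentation of `⟨n,n,n⟩`, `n ≥ 2`, as a restriction of the windowed Hadamard product
`[α b + β c = γ a]·S(γ a, α b, β c)` over an abelian `G` with `|G| ≤ n^(2+ε)`, `R(S) ≤ n^ε`) and the
two provable-now supports `HadamardRankLe` (`R(s∘t) ≤ R(s)·R(t)`) and `AddTableRankLe`
(`R([u+v=g]) ≤ |G|`) decide `ω(ℂ) = 2`: for `δ > 0` take `ε = δ/2`; then
`R(⟨n,n,n⟩) ≤ R(window) ≤ R(T) ≤ R(U_G)·R(S) ≤ |G|·R(S) ≤ n^(2+δ/2)·n^(δ/2) = n^(2+δ)`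
(`TensorRestrictsTo.tensorRank_le`; `tensorRestrictsTo_precomp` with `T g u v = [u+v=g]·S g u v`,
the window being `T ∘ (γ, α, β)`; the two supports), so `ω(ℂ) ≤ log_n(|G|·R(S)) ≤ 2 + δ`
(`advxxz2025_omega_le_logb_of_tensorRank_le`, proved in the cone); `2 ≤ ω(ℂ)` is the proved
flattening bound `omega_two_le`. No named unproved fact is used. -/
@[closes "route-MatrixMultiplication-WindowedCompletionRank"] theorem closes (hH : HadamardRankLe) (hA : AddTableRankLe) (hT : Thesis) : MatrixMultiplication := by
  rw [MatrixMultiplication_iff]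
  refine le_antisymm ?_ (Literature.Computability.AlgebraicComplexity.omega_two_le ℂ)
  refine le_of_forall_pos_le_add fun δ hδ => ?_
  obtain ⟨n, hn, G, instG, instF, instD, hcard, α, β, γ, S, hS, hres⟩ := hT (δ / 2) (half_pos hδ)
  -- R(⟨n,n,n⟩) ≤ R(window)
  have h1 : Literature.Computability.AlgebraicComplexity.tensorRank
      (Literature.Computability.AlgebraicComplexity.matMulTensor ℂ n n n) ≤
      Literature.Computability.AlgebraicComplexity.tensorRank
        (fun a b c : Fin n × Fin n => if α b + β c = γ a then S (γ a) (α b) (β c) else 0) :=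
    hres.tensorRank_le
  -- window = T ∘ (γ, α, β) with T g u v = [u + v = g] · S g u v
  have h2 : Literature.Computability.AlgebraicComplexity.TensorRestrictsTo
      (fun g u v : G => if u + v = g then S g u v else 0)
      (fun a b c : Fin n × Fin n => if α b + β c = γ a then S (γ a) (α b) (β c) else 0) :=
    Literature.Computability.AlgebraicComplexity.tensorRestrictsTo_precomp
      (fun g u v : G => if u + v = g then S g u v else 0) γ α β
  -- T = U_G ∘ S entrywise
  have hEq : (fun g u v : G => if u + v = g then S g u v else 0) =
      fun g u v : G => (if u + v = g then (1 : ℂ) else 0) * S g u v := by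
    funext g u v
    split_ifs <;> simp
  have h3 : Literature.Computability.AlgebraicComplexity.tensorRank
      (fun g u v : G => if u + v = g then S g u v else 0) ≤
      Literature.Computability.AlgebraicComplexity.tensorRank
        (fun g u v : G => if u + v = g then (1 : ℂ) else 0) *
      Literature.Computability.AlgebraicComplexity.tensorRank S := by
    rw [hEq]
    exact hH G G G (fun g u v : G => if u + v = g then (1 : ℂ) else 0) S
  -- R(U_G) ≤ |G|
  have h4 : Literature.Computability.AlgebraicComplexity.tensorRank
      (fun g u v : G => if u + v = g then (1 : ℂ) else 0) ≤ Fintype.card G := hA G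
  have hr : Literature.Computability.AlgebraicComplexity.tensorRank
      (Literature.Computability.AlgebraicComplexity.matMulTensor ℂ n n n) ≤
      Fintype.card G * Literature.Computability.AlgebraicComplexity.tensorRank S :=
    h1.trans (h2.tensorRank_le.trans (h3.trans (Nat.mul_le_mul_right _ h4)))
  have hω :=
    Literature.Computability.AlgebraicComplexity.advxxz2025_omega_le_logb_of_tensorRank_le ℂ hn hr
  refine hω.trans ?_
  have hn1 : (1 : ℝ) < n := by exact_mod_cast (lt_of_lt_of_le (by norm_num) hn)
  have hn0 : (0 : ℝ) < n := by linarith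
  rcases Nat.eq_zero_or_pos
      (Fintype.card G * Literature.Computability.AlgebraicComplexity.tensorRank S) with h0 | hpos
  · rw [h0, Nat.cast_zero, Real.logb_zero]
    linarith
  · rw [Real.logb_le_iff_le_rpow hn1 (by exact_mod_cast hpos), Nat.cast_mul]
    calc (Fintype.card G : ℝ) * (Literature.Computability.AlgebraicComplexity.tensorRank S : ℝ)
        ≤ (n : ℝ) ^ (2 + δ / 2) * (n : ℝ) ^ (δ / 2) :=
          mul_le_mul hcard hS (Nat.cast_nonneg _) (Real.rpow_nonneg hn0.le _)
      _ = (n : ℝ) ^ (2 + δ) := by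
          rw [← Real.rpow_add hn0]
          congr 1
          ring

end Summit.MatrixMultiplication.MatrixMultiplication.Theses.WindowedCompletionRank
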